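/-
Copyright (c) 2026 the pub-hodgecm-mathlib formalisation cell (harness21).  Prover seat hodgecm-mathlib-K2E3-p06 (g7), Track B «K2-LIT»,
#184♮ = hLiu418 = `stmt-HodgeConjecture-24832`; socket #41, KIND W, (iii-fin) row (KW-fin-stab) — LEAD F0P6-plan (g15) BATCH #215 (1), KW desk F0P2-p08 (g4)
(R) POLE RE-CUT 01:23:54Z + ARCHITECT NOTE #1 01:33:21Z: FILE 2′ of the QUANTITATIVE radius-stability letter `hstab` of ★ p863720 — Karel's lemma with the radius
EXPLICIT in the level AND in the two supply radii (no `∃` at all), so that the (iii-fin) letter's place constants vanish off a finite set.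
THEOREMS ONLY (no `def`, no `instance`, no notation, no named-fact hypothesis, no `sorry`); lane `--supports stmt-HodgeConjecture-24832` (count-neutral helper).
-/
import Summits.HodgeConjecture.HodgeConjecture.Theorems.K2LiuBadPlaceWhittakerFarShells   -- ★ F4b-1: `setIntegral_farShell_eq_zero` and its §1 tools; brings ★ F4a, ★ F3a, ★ F3c-1∕2
import Summits.HodgeConjecture.HodgeConjecture.Theorems.K2LiuLocalLeviSupplyLevel         -- ★ FILE 1 p864100 (this seat): `levi_apply_mem_congruenceGL_pow`
import HarnessLib

/-!
# Crux `HLiu418`, socket #41, KIND W, (KW-fin-stab) FILE 2′ — `K2LiuBadPlaceWhittakerFarShellsRadii`: KAREL'S LEMMA WITH A FULLY EXPLICIT RADIUS —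
# the far shells are dead for `k ≥ j₀⁺ + j₁⁺ + |d| + 2|c_ε| + 2|c₂| + 2|b_T| + 2 + Σ_w M_w + 4b + 2b′` (NO `∃`: the level `M`, the supply radius `j₀`, the integrality radius `j₁` BY VALUE)

Cell `hodgecm-mathlib`, crux item hLiu418 = `stmt-HodgeConjecture-24832` (helper lane `--supports … --as helper`, count-neutral), route of record `HCCMUnconditional`;
squad K2 ∕ K2Liu, road `K2_Liu`, socket #41 `sig_K2LiuSiegelEisensteinContinuation`, KIND W, (iii-fin) row (KW-fin-stab).  WHY THIS EDITION (architect note #1, K2 bus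
2026-09-05T01:33:21Z): the (iii-fin) radius-stability letter `hstab` of ★ p863720 must have its place constants `ρ w` VANISH off a fixed finite set while the place `v` ranges over
`kindWFinset T₀ S h` (unboundedly many places as `(S, h)` vary); so every constant inside Karel's radius must be an explicit finite-support function of the place.  ★ FILE 2
`K2LiuBadPlaceWhittakerFarShellsLevel.setIntegral_farShell_eq_zero_of_level` (p864134) made the LEVEL explicit but still hides, inside its `∃ K₀`, ★ F3a's Levi-supply radius
`j₀` and ★ F4b-1's integrality radius `j₁` — both `∃`s by continuity, opaque per place.  THIS FILE takes BOTH BY VALUE, as letters: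
* `hsup` (radius `j₀`): for every direction `u = single a b e`, `e ∈ {1, ε}`, and every `z ∈ 𝔭_v^{j₀}`, a Siegel–Levi move `q ∈ H(F_v)` with `blkC = 0 = blkB`, `blkA = 1 + ẑ•u`,
  `blkD⁻¹ = 1 + ẑ•(T⁻¹σ(u)ᵀT)`, `χ_det(w_Δ q w_Δ) = 1`, `|det_Δ(w_Δ q w_Δ)| = 1` (payers: ★ F3a `exists_ball_levi_supply` at `U := ⊤` — opaque `j₀`, any place; FILE 2b
  `K2LiuLocalLeviSupplyExplicit` — explicit `j₀` from the conductor exponents of the `χ_w`);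
* `hinv` (radius `j₁`): for the same directions and `z ∈ 𝔭_v^{j₁}`, `(1 + ẑ•u)⁻¹` and `(1 + ẑ•u′)⁻¹` lie in `ball(0)` (payers: ★ F4b-1 `eventually_mball_zero_inv_one_add_smul` — opaque;
  FILE 2b — `j₁ := 2|b_T| + 1` via ★ `isUnit_det_and_valBound_inv`);
and the principal LEVEL `M : (w ∣ v) → ℕ` of the family (`hfM`, ★ p863964 currency) as in ★ FILE 2.  THE THEOREM **`setIntegral_farShell_eq_zero_of_radii`**: for every `T`-skew index
`β` with `ββ⁻ = 1`, `β ∈ ball(−b)`, `β⁻ ∈ ball(−b′)` (`0 ≤ b, b′`, `2b_T ≤ b`), every **`k ≥ max j₀ 0 + max j₁ 0 + |d| + 2|c_ε| + 2|c₂| + 2|b_T| + 2 + Σ_w M_w + 4b + 2b′`** and every `s`: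
`∫_{B(−k) ∖ B(−k+1)} f s (w_Δ n(t))·ψ(−τ tr(β t)) dμ = 0`.  PROOF = ★ F4b-1's assembly over ★ F4a `setIntegral_shell_eq_zero_of_levi` VERBATIM with `hsup`∕`hinv` in place of the two
`choose`s, and ★ FILE 1 `K2LiuLocalLeviSupplyLevel.levi_apply_mem_congruenceGL_pow` putting the moves in `∏_w K_w(ϖ_w^{M_w})` (`M_w + 2|b_T| + c₂ ≤ j`, averaging radius
`j := d + k − 1 − c_ε − c₂ − b′`).  The character letter `hχv` of ★ F4b-1 is no longer needed (it only fed ★ F3a).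
[Casselman1980, §3]; [KudlaRallis1994, §2]; [Shimura1997, §18]; [HarrisKudlaSweet1996, §1 (1.11)–(1.15)]; [PlatonovRapinchuk1994, §5.1].
HONEST LABEL.  Count-neutral helper, closes no socket: `HC_CM` is proved only modulo the 7 printed citations (2 remaining named inputs: hLiu418 = `stmt-HodgeConjecture-24832`,
h413 = `stmt-HodgeConjecture-24833`) until rung 0 closes.  NOT HERE: the dischargers of `hsup`∕`hinv` with explicit radii (FILE 2b), the Φ5-tie twin + translate (F0P2-p09 (g3)
`K2LiuBadPlaceWhittakerBallLevel`), the (iii-fin) dress (K2E3-p29 (g3) `K2LiuKindWFiniteRadiusStabilityOfLetters`).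

## References
* [Casselman1980] W. Casselman, *The unramified principal series of p-adic groups I*, Compositio Math. 40 (1980): §3.
* [KudlaRallis1994] S. Kudla, S. Rallis, *A regularized Siegel–Weil formula: the first term identity*, Ann. of Math. 140 (1994): §2.
* [Shimura1997] G. Shimura, *Euler products and Eisenstein series*, CBMS 93 (1997): §18.
* [HarrisKudlaSweet1996] M. Harris, S. Kudla, W. J. Sweet, *Theta dichotomy for unitary groups*, J. AMS 9 (1996): §1 (1.11)–(1.15).
* [PlatonovRapinchuk1994] V. Platonov, A. Rapinchuk, *Algebraic Groups and Number Theory* (1994): §5.1.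
-/

set_option autoImplicit false
-- the mandated namespace repeats the single-problem summit's segment (`HodgeConjecture.HodgeConjecture`)
set_option linter.dupNamespace false

noncomputable section

open scoped NNReal ENNReal Matrix Topology
open NumberField IsDedekindDomain Matrix MeasureTheory Set Filter
open Literature.NumberTheory.Automorphic Literature.NumberTheory.Automorphic.UnitaryGroup
open Literature.NumberTheory.GelbartRogawski1991.AdaptedBlocks
open Literature.NumberTheory.GelbartRogawski1991.UnitaryDualPair.LocalSplitting
open Literature.NumberTheory.K2Lit.LocalSiegelDoubled
open Summit.HodgeConjecture.HodgeConjecture.Cruxes.HLiu418.K2LiuSiegelLeviWeylAlgebra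
open Summit.HodgeConjecture.HodgeConjecture.Cruxes.HLiu418.K2LiuShellVanishingByAveraging
open Summit.HodgeConjecture.HodgeConjecture.Cruxes.HLiu418.K2LiuBadPlaceWhittakerShells
open Summit.HodgeConjecture.HodgeConjecture.Cruxes.HLiu418.K2LiuLocalLeviSupply
open Summit.HodgeConjecture.HodgeConjecture.Cruxes.HLiu418.K2LiuLocalRingValuationBalls
open Summit.HodgeConjecture.HodgeConjecture.Cruxes.HLiu418.K2LiuWhittakerCharacterMoves
open Summit.HodgeConjecture.HodgeConjecture.Cruxes.HLiu418.K2LiuBadPlaceWhittakerFarShells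
open Summit.HodgeConjecture.HodgeConjecture.Cruxes.HLiu418.K2LiuLocalLeviSupplyLevel (levi_apply_mem_congruenceGL_pow)

namespace Summit.HodgeConjecture.HodgeConjecture.Cruxes.HLiu418.K2LiuBadPlaceWhittakerFarShellsRadii

variable (F : Type) [Field F] [NumberField F] (E : Type) [Field E] [NumberField E] [Algebra F E]
  [Algebra.IsQuadraticExtension F E] (c : E ≃ₐ[F] E)
  {δ : E} (hcδ : c δ = -δ) (hδ : δ ≠ 0) {dd : F} (hd : δ * δ = algebraMap F E dd)
  (v : HeightOneSpectrum (𝓞 F)) (n : ℕ) {T₀ : Matrix (Fin n) (Fin n) F} (hT₀ : T₀.IsSymm) (hT₀d : IsUnit T₀.det)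
  {JD : Matrix (Fin (n + n)) (Fin (n + n)) E} (hJD : JD = (gramD F n T₀).map (algebraMap F E))
  {π : v.adicCompletion F} (hπ : Valued.v π = WithZero.exp (-1 : ℤ))

/-! ## The far shells vanish beyond a fully explicit radius -/

include hcδ hδ hd hT₀ hT₀d hJD hπ in
/-- **THE FAR SHELLS OF THE BAD-PLACE WHITTAKER INTEGRAL VANISH BEYOND `max j₀ 0 + max j₁ 0 + |d| + 2|c_ε| + 2|c₂| + 2|b_T| + 2 + Σ_w M_w + 4b + 2b′`** (Karel's lemma
with a FULLY EXPLICIT radius).  Frame letters as ★ F4b-1 `setIntegral_farShell_eq_zero` (minus its character letter `hχv`), uniformisers `ϖ_w` of the `E_w`, and BY VALUE: the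
Levi-supply letter `hsup` at radius `j₀` (a Siegel–Levi move `m(1 + ẑu)` with `χ_det = 1`, `|det_Δ| = 1` for every direction `u = single a b e`, `e ∈ {1, ε}`, `z ∈ 𝔭_v^{j₀}`), the
integrality letter `hinv` at radius `j₁`, the level `M : (w ∣ v) → ℕ` of the family `f s` (`hfM`) with its pull-back regularity `hφm hφC`, the index `β` with `ββ⁻ = 1`,
`β ∈ ball(−b)`, `β⁻ ∈ ball(−b′)` (`0 ≤ b, b′`, `2b_T ≤ b`).  THEN for every `k` beyond the displayed radius and every `s`: `∫_{B(−k) ∖ B(−k+1)} f s (w_Δ n(t))·ψ(−τ(tr(β t))) dμ(t) = 0`.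
PROOF: ★ F4a `setIntegral_shell_eq_zero_of_levi` at the averaging radius `j := d + k − 1 − c_ε − c₂ − b′`, the moves of `hsup` lying in `∏_w K_w(ϖ_w^{M_w})` by ★ FILE 1
`levi_apply_mem_congruenceGL_pow` (`M_w + 2|b_T| + c₂ ≤ j`), lattice ∕ character ∕ box ∕ covering letters exactly as ★ F4b-1.
[cite: Casselman1980, §3] [cite: KudlaRallis1994, §2] [cite: Shimura1997, §18] -/
theorem setIntegral_farShell_eq_zero_of_radii
    (S : AddSubgroup (Matrix (Fin n) (Fin n) (LocalRing E v)))
    (hS : ∀ t, t ∈ S ↔ (t.map (conjLocal E c v))ᵀ * gramS F E v n T₀ + gramS F E v n T₀ * t = 0)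
    [MeasurableSpace S] [BorelSpace S] [LocallyCompactSpace S] (μ : Measure S) [μ.IsAddHaarMeasure] [μ.Regular]
    [MeasurableSpace (v.adicCompletion F)] [BorelSpace (v.adicCompletion F)] (μF : Measure (v.adicCompletion F)) [μF.IsAddHaarMeasure]
    -- the characters `χ_w` (no topological letter: the supply letter `hsup` below carries `χ_det = 1`)
    {χv : ∀ w : PlacesOver E v, (w.1.adicCompletion E)ˣ →* ℂˣ}
    -- the additive character and the trace-type functional
    {ψ : AddChar (v.adicCompletion F) Circle} (hψ : Continuous ψ) {d : ℤ} (hdψ : ψ.HasConductorExp d)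
    {τ : LocalRing E v → v.adicCompletion F} (hτ : ∀ r, toLocalRing E v (τ r) = r + conjLocal E c v r) (hτadd : ∀ r s, τ (r + s) = τ r + τ s)
    (hτs : ∀ (z : v.adicCompletion F) (r : LocalRing E v), τ (toLocalRing E v z * r) = z * τ r) (hτc : Continuous τ)
    -- the anti-invariant integral element and the constants
    {ε : LocalRing E v} (hεσ : conjLocal E c v ε = -ε) (hεint : ∀ w : PlacesOver E v, Valued.v (ε w) ≤ 1) {cε c₂ bT : ℤ}
    (hε : ∀ w : PlacesOver E v, Valued.v (toPlace v w π) ^ cε ≤ Valued.v ((2 * ε) w))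
    (h2 : ∀ w : PlacesOver E v, Valued.v (toPlace v w π) ^ c₂ ≤ Valued.v ((2 : LocalRing E v) w))
    (hTb : ∀ i j (w : PlacesOver E v), Valued.v (gramS F E v n T₀ i j w) ≤ Valued.v (toPlace v w π) ^ (-bT))
    (hTib : ∀ i j (w : PlacesOver E v), Valued.v ((gramS F E v n T₀)⁻¹ i j w) ≤ Valued.v (toPlace v w π) ^ (-bT))
    -- THE LEVI-SUPPLY LETTER at radius `j₀` (★ F3a's conclusion shape, per direction `single a b e`, `e = if bb then ε else 1`) and THE INTEGRALITY LETTER at radius `j₁`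
    (j₀ : ℤ)
    (hsup : ∀ (a b : Fin n) (bb : Bool), ∀ z ∈ primePowBall (v.adicCompletion F) j₀, ∃ q : UnitaryGroup.localPi E c (n + n) JD v,
      blkC (matA F E c v n q) = 0 ∧ blkB (matA F E c v n q) = 0 ∧
      blkA (matA F E c v n q) = 1 + toLocalRing E v z • Matrix.single a b (if bb then ε else (1 : LocalRing E v)) ∧
      (blkD (matA F E c v n q))⁻¹ = 1 + toLocalRing E v z •
        ((gramS F E v n T₀)⁻¹ * ((Matrix.single a b (if bb then ε else (1 : LocalRing E v))).map (conjLocal E c v))ᵀ * gramS F E v n T₀) ∧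
      chiDet F E c v n χv (weylDelta F E c v n hJD * q * weylDelta F E c v n hJD) = 1 ∧
      absDetDelta F E c v n (weylDelta F E c v n hJD * q * weylDelta F E c v n hJD) = 1)
    (j₁ : ℤ)
    (hinv : ∀ (a b : Fin n) (bb : Bool), ∀ z ∈ primePowBall (v.adicCompletion F) j₁,
      (∀ a' b' (w : PlacesOver E v), Valued.v ((1 + toLocalRing E v z • Matrix.single a b (if bb then ε else (1 : LocalRing E v)))⁻¹ a' b' w) ≤
        Valued.v (toPlace v w π) ^ (0 : ℤ)) ∧
      (∀ a' b' (w : PlacesOver E v), Valued.v ((1 + toLocalRing E v z •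
        ((gramS F E v n T₀)⁻¹ * ((Matrix.single a b (if bb then ε else (1 : LocalRing E v))).map (conjLocal E c v))ᵀ * gramS F E v n T₀))⁻¹ a' b' w) ≤
        Valued.v (toPlace v w π) ^ (0 : ℤ)))
    -- lattice facts (★ F3b by shape)
    (hBm : ∀ a : ℤ, MeasurableSet {t : S | ∀ i j (w : PlacesOver E v), Valued.v (t.1 i j w) ≤ Valued.v (toPlace v w π) ^ a})
    (hBfin : ∀ a : ℤ, μ {t : S | ∀ i j (w : PlacesOver E v), Valued.v (t.1 i j w) ≤ Valued.v (toPlace v w π) ^ a} ≠ ∞)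
    (hB0 : μ {t : S | ∀ i j (w : PlacesOver E v), Valued.v (t.1 i j w) ≤ Valued.v (toPlace v w π) ^ (0 : ℤ)} ≠ 0)
    (hpre : ∀ (L : S ≃ₜ+ S) (A D' A' D'' : Matrix (Fin n) (Fin n) (LocalRing E v)), (∀ t : S, (L t).1 = A * t.1 * D') →
      (∀ t : S, (L.symm t).1 = A' * t.1 * D'') →
      (∀ i j (w : PlacesOver E v), Valued.v (A i j w) ≤ Valued.v (toPlace v w π) ^ (0 : ℤ)) →
      (∀ i j (w : PlacesOver E v), Valued.v (D' i j w) ≤ Valued.v (toPlace v w π) ^ (0 : ℤ)) →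
      (∀ i j (w : PlacesOver E v), Valued.v (A' i j w) ≤ Valued.v (toPlace v w π) ^ (0 : ℤ)) →
      (∀ i j (w : PlacesOver E v), Valued.v (D'' i j w) ≤ Valued.v (toPlace v w π) ^ (0 : ℤ)) →
      ∀ a : ℤ, L ⁻¹' {t : S | ∀ i j (w : PlacesOver E v), Valued.v (t.1 i j w) ≤ Valued.v (toPlace v w π) ^ a} =
        {t : S | ∀ i j (w : PlacesOver E v), Valued.v (t.1 i j w) ≤ Valued.v (toPlace v w π) ^ a})
    -- uniformisers of the `E_w`, `w ∣ v` (the currency of the principal levels `K_w(ϖ_w^M)`)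
    {ϖ : (w : PlacesOver E v) → w.1.adicCompletion E} (hϖ : ∀ w, Valued.v (ϖ w) = WithZero.exp (-1 : ℤ)) :
    ∀ (M : PlacesOver E v → ℕ) (f : ℂ → UnitaryGroup.localPi E c (n + n) JD v → ℂ),
      (∀ s, IsLocalSiegelSection F E c hcδ hδ hd v n hT₀ hJD χv s (f s)) →
      (∀ s g (k : UnitaryGroup.localPi E c (n + n) JD v),
        (∀ w : PlacesOver E v, (k : UnitaryGroup.LocalGLPi E (n + n) v) w ∈ congruenceGL (n + n) (ValuativeRel.valuation (w.1.adicCompletion E) (ϖ w) ^ M w)) →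
        f s (g * k) = f s g) →
      (∀ s, Measurable fun t : S => f s (weylDelta F E c v n hJD * nElem F E c v n hJD t.1 ((hS t.1).1 t.2))) →
      (∀ s (k : ℤ), ∃ C : ℝ, ∀ t : S, (∀ i j (w : PlacesOver E v), Valued.v (t.1 i j w) ≤ Valued.v (toPlace v w π) ^ (-k)) →
        ‖f s (weylDelta F E c v n hJD * nElem F E c v n hJD t.1 ((hS t.1).1 t.2))‖ ≤ C) →
      ∀ (b b' : ℤ) (β βinv : Matrix (Fin n) (Fin n) (LocalRing E v)), 0 ≤ b → 0 ≤ b' → 2 * bT ≤ b →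
      (β.map (conjLocal E c v))ᵀ * gramS F E v n T₀ + gramS F E v n T₀ * β = 0 → β * βinv = 1 →
      (∀ i j (w : PlacesOver E v), Valued.v (β i j w) ≤ Valued.v (toPlace v w π) ^ (-b)) →
      (∀ i j (w : PlacesOver E v), Valued.v (βinv i j w) ≤ Valued.v (toPlace v w π) ^ (-b')) →
      ∀ k : ℤ, max j₀ 0 + max j₁ 0 + |d| + 2 * |cε| + 2 * |c₂| + 2 * |bT| + 2 + (∑ w : PlacesOver E v, (M w : ℤ)) + 4 * b + 2 * b' ≤ k → ∀ s : ℂ,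
        ∫ t in {t : S | ∀ i j (w : PlacesOver E v), Valued.v (t.1 i j w) ≤ Valued.v (toPlace v w π) ^ (-k)} \
            {t : S | ∀ i j (w : PlacesOver E v), Valued.v (t.1 i j w) ≤ Valued.v (toPlace v w π) ^ (-k + 1)},
          f s (weylDelta F E c v n hJD * nElem F E c v n hJD t.1 ((hS t.1).1 t.2)) * ((ψ (-τ (Matrix.trace (β * t.1))) : Circle) : ℂ) ∂μ = 0 := by
  classical
  -- abbreviations
  set T : Matrix (Fin n) (Fin n) (LocalRing E v) := gramS F E v n T₀ with hTdef
  have hT : IsUnit T.det := isUnit_det_gramS' F E v n hT₀d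
  have hTt : Tᵀ = T := gramS_transpose F E v n hT₀
  -- the directions `u i` and their Levi twists `u′ i`
  let ι := (Fin n × Fin n) × Bool
  let uu : ι → Matrix (Fin n) (Fin n) (LocalRing E v) := fun i => Matrix.single i.1.1 i.1.2 (if i.2 then ε else 1)
  let uu' : ι → Matrix (Fin n) (Fin n) (LocalRing E v) := fun i => T⁻¹ * ((uu i).map (conjLocal E c v))ᵀ * T
  have hesc : ∀ bb : Bool, ∀ w : PlacesOver E v, Valued.v ((if bb then ε else (1 : LocalRing E v)) w) ≤ 1 := by
    intro bb w; cases bb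
    · simp only [Bool.false_eq_true, ↓reduceIte, Pi.one_apply, map_one, le_refl]
    · exact hεint w
  have huu0 : ∀ i, ∀ a b (w : PlacesOver E v), Valued.v (uu i a b w) ≤ Valued.v (toPlace v w π) ^ (0 : ℤ) := fun i =>
    mball_single F E v n (hesc i.2) i.1.1 i.1.2
  have huu' : ∀ i, ∀ a b (w : PlacesOver E v), Valued.v (uu' i a b w) ≤ Valued.v (toPlace v w π) ^ (-(2 * bT)) := by
    intro i
    have h := mball_mul F E v hπ (mball_mul F E v hπ hTib (mball_conjTranspose F E c v (huu0 i))) hTb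
    intro a b w; rw [show -(2 * bT) = -bT + 0 + -bT by ring]; exact h a b w
  have huu'abs : ∀ i, ∀ a b (w : PlacesOver E v), Valued.v (uu' i a b w) ≤ Valued.v (toPlace v w π) ^ (-(2 * |bT|)) := fun i =>
    mball_antitone F E v hπ (by have := le_abs_self bT; omega) (huu' i)
  -- (1)+(2) the Siegel–Levi supply (blocks, `χ_det = 1`, `|det_Δ| = 1`) at radius `j₀` and the integrality letter at radius `j₁`, per direction — BY VALUE
  have hj₀ : ∀ i : ι, ∀ z ∈ primePowBall (v.adicCompletion F) j₀, ∃ q : UnitaryGroup.localPi E c (n + n) JD v,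
      blkC (matA F E c v n q) = 0 ∧ blkB (matA F E c v n q) = 0 ∧ blkA (matA F E c v n q) = 1 + toLocalRing E v z • uu i ∧
      (blkD (matA F E c v n q))⁻¹ = 1 + toLocalRing E v z • uu' i ∧
      chiDet F E c v n χv (weylDelta F E c v n hJD * q * weylDelta F E c v n hJD) = 1 ∧
      absDetDelta F E c v n (weylDelta F E c v n hJD * q * weylDelta F E c v n hJD) = 1 := fun i z hz => hsup i.1.1 i.1.2 i.2 z hz
  have hj₁ : ∀ i : ι, ∀ z ∈ primePowBall (v.adicCompletion F) j₁,
      (∀ a b (w : PlacesOver E v), Valued.v ((1 + toLocalRing E v z • uu i)⁻¹ a b w) ≤ Valued.v (toPlace v w π) ^ (0 : ℤ)) ∧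
      (∀ a b (w : PlacesOver E v), Valued.v ((1 + toLocalRing E v z • uu' i)⁻¹ a b w) ≤ Valued.v (toPlace v w π) ^ (0 : ℤ)) := fun i z hz => hinv i.1.1 i.1.2 i.2 z hz
  intro M f hf hfM hφm hφC b b' β βinv hb hb' hbTb hβskew hββ hβ hβinv k hk s
  -- the principal level `∏_w K_w(ϖ_w^{M_w})` as a subgroup of `H(F_v)`
  set U : Subgroup (UnitaryGroup.localPi E c (n + n) JD v) := ⨅ w : PlacesOver E v,
    (congruenceGL (n + n) (ValuativeRel.valuation (w.1.adicCompletion E) (ϖ w) ^ M w)).comap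
      ((Pi.evalMonoidHom (fun w' : PlacesOver E v => GL (Fin (n + n)) (w'.1.adicCompletion E)) w).comp (UnitaryGroup.localPi E c (n + n) JD v).subtype) with hUdef
  have hmemU : ∀ q : UnitaryGroup.localPi E c (n + n) JD v,
      (∀ w : PlacesOver E v, (q : UnitaryGroup.LocalGLPi E (n + n) v) w ∈ congruenceGL (n + n) (ValuativeRel.valuation (w.1.adicCompletion E) (ϖ w) ^ M w)) ↔ q ∈ U := by
    intro q
    rw [hUdef, Subgroup.mem_iInf]
    exact forall_congr' fun w => by rw [Subgroup.mem_comap]; rfl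
  have hfU : ∀ s g (q : UnitaryGroup.localPi E c (n + n) JD v), q ∈ U → f s (g * q) = f s g := fun s g q hq => hfM s g q ((hmemU q).2 hq)
  -- the averaging radius
  set j : ℤ := d + k - 1 - cε - c₂ - b' with hjdef
  have hf1 := le_max_left j₀ 0
  have hf1' := le_max_right j₀ 0
  have hf2 := le_max_left j₁ 0
  have hf2' := le_max_right j₁ 0
  have hf3 := abs_nonneg d
  have hf4 := abs_nonneg cε
  have hf5 := abs_nonneg c₂
  have hf6 := le_abs_self d
  have hf7 := neg_abs_le d
  have hf8 := le_abs_self cε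
  have hf9 := le_abs_self c₂
  have hf10 := le_abs_self bT
  have hf11 := abs_nonneg bT
  have hM0 : (0 : ℤ) ≤ ∑ w : PlacesOver E v, (M w : ℤ) := Finset.sum_nonneg fun w _ => Int.natCast_nonneg _
  have hMle : ∀ w : PlacesOver E v, (M w : ℤ) ≤ ∑ w' : PlacesOver E v, (M w' : ℤ) := fun w =>
    Finset.single_le_sum (f := fun w' : PlacesOver E v => (M w' : ℤ)) (fun _ _ => Int.natCast_nonneg _) (Finset.mem_univ w)
  have hJ0 : j₀ ≤ j := by omega
  have hJ1 : j₁ ≤ j := by omega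
  have hjM : ∀ w : PlacesOver E v, (M w : ℤ) + 2 * |bT| + c₂ ≤ j := fun w => by have := hMle w; omega
  have hj0 : 0 ≤ j := by omega
  have hbj : b ≤ j := by omega
  have h2j : k + 4 * b + d ≤ 2 * j := by omega
  have hb2 : ∀ i, ∀ a b₁ (w : PlacesOver E v), Valued.v (uu i a b₁ w) ≤ Valued.v (toPlace v w π) ^ (-b) := fun i =>
    mball_antitone F E v hπ (by omega) (huu0 i)
  have hb2' : ∀ i, ∀ a b₁ (w : PlacesOver E v), Valued.v (uu' i a b₁ w) ≤ Valued.v (toPlace v w π) ^ (-b) := fun i =>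
    mball_antitone F E v hπ (by omega) (huu' i)
  -- (3) the moves: Levi elements `q i z` (in the principal level by ★ FILE 1) and conjugations `L i z`, with their properties, for `z ∈ 𝔭^j`
  have hmoves : ∀ (i : ι) (z : v.adicCompletion F), ∃ (q : UnitaryGroup.localPi E c (n + n) JD v) (L : S ≃ₜ+ S),
      z ∈ primePowBall (v.adicCompletion F) j →
        q ∈ U ∧ blkC (matA F E c v n q) = 0 ∧ blkB (matA F E c v n q) = 0 ∧
        chiDet F E c v n χv (weylDelta F E c v n hJD * q * weylDelta F E c v n hJD) = 1 ∧
        absDetDelta F E c v n (weylDelta F E c v n hJD * q * weylDelta F E c v n hJD) = 1 ∧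
        (∀ t : S, (L t).1 = blkA (matA F E c v n q) * t.1 * (blkD (matA F E c v n q))⁻¹) ∧
        blkA (matA F E c v n q) = 1 + toLocalRing E v z • uu i ∧ (blkD (matA F E c v n q))⁻¹ = 1 + toLocalRing E v z • uu' i ∧
        (∀ a : ℤ, L ⁻¹' {t : S | ∀ i j (w : PlacesOver E v), Valued.v (t.1 i j w) ≤ Valued.v (toPlace v w π) ^ a} =
          {t : S | ∀ i j (w : PlacesOver E v), Valued.v (t.1 i j w) ≤ Valued.v (toPlace v w π) ^ a}) := by
    intro i z
    by_cases hz : z ∈ primePowBall (v.adicCompletion F) j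
    · obtain ⟨q, hC, hB, hA, hDinv, hχ, habs⟩ := hj₀ i z (primePowBall_antitone hJ0 hz)
      have hqS : IsSiegelDelta F E c hcδ hδ hd v n hT₀ hJD q := (isSiegelDelta_iff_blkC_eq_zero F E c hcδ hδ hd v n hT₀ hJD q).2 hC
      obtain ⟨L, hL⟩ := exists_continuousAddEquiv_levi_conj F E c hcδ hδ hd v n hT₀ hJD S hS hqS
      obtain ⟨hAinvint, hDint⟩ := hj₁ i z (primePowBall_antitone hJ1 hz)
      -- THE LEVEL: `q ∈ ∏_w K_w(ϖ_w^{M_w})` by ★ FILE 1 (`M_w + 2|b_T| + c₂ ≤ j`)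
      have hqU : q ∈ U := (hmemU q).1 fun w =>
        levi_apply_mem_congruenceGL_pow F E c v n hπ q hC hB hz (bu := 2 * |bT|) (by positivity) (huu0 i) (huu'abs i) hA hDinv hAinvint hDint
          w (h2 w) (hϖ w) (M w) (hjM w)
      refine ⟨q, L, fun _ => ⟨hqU, hC, hB, hχ, habs, hL, hA, hDinv, ?_⟩⟩
      -- lattice invariance: the four blocks `A`, `D⁻¹`, `A⁻¹`, `D` are integral
      obtain ⟨hAu, hDu⟩ := isUnit_det_blkA_blkD F E c v n hC
      have hz0 : z ∈ primePowBall (v.adicCompletion F) 0 := primePowBall_antitone hj0 hz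
      have hAint : ∀ a b₁ (w : PlacesOver E v), Valued.v (blkA (matA F E c v n q) a b₁ w) ≤ Valued.v (toPlace v w π) ^ (0 : ℤ) := by
        rw [hA]
        have h := mball_add F E v (mball_one F E v (m := Fin n) (π := π))
          (mball_antitone F E v hπ (a := 0) (b := 0 + 0) (by omega) (mball_smul F E v hπ hz0 (huu0 i)))
        exact h
      have hDinvint : ∀ a b₁ (w : PlacesOver E v), Valued.v ((blkD (matA F E c v n q))⁻¹ a b₁ w) ≤ Valued.v (toPlace v w π) ^ (0 : ℤ) := by
        rw [hDinv]
        have hzb : z ∈ primePowBall (v.adicCompletion F) (2 * bT) := primePowBall_antitone (by omega) hz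
        have h := mball_add F E v (mball_one F E v (m := Fin n) (π := π))
          (mball_antitone F E v hπ (a := 0) (b := 2 * bT + -(2 * bT)) (by omega) (mball_smul F E v hπ hzb (huu' i)))
        exact h
      rw [← hA] at hAinvint
      rw [← hDinv, Matrix.nonsing_inv_nonsing_inv _ hDu] at hDint
      have hsymm : ∀ t : S, (L.symm t).1 = (blkA (matA F E c v n q))⁻¹ * t.1 * blkD (matA F E c v n q) :=
        symm_apply_eq_of_apply_eq F E v n L hL (Matrix.nonsing_inv_mul _ hAu) (Matrix.nonsing_inv_mul _ hDu)
      exact hpre L _ _ _ _ hL hsymm hAint hDinvint hAinvint hDint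
    · exact ⟨1, ContinuousAddEquiv.refl S, fun h => absurd h hz⟩
  choose q L hqL using hmoves
  -- (4) feed ★ F4a
  obtain ⟨C, hC⟩ := hφC s k
  have hχcont : Continuous fun t : S => ((ψ (-τ (Matrix.trace (β * t.1))) : Circle) : ℂ) :=
    continuous_subtype_val.comp (hψ.comp (hτc.comp (continuous_const.matrix_mul continuous_subtype_val).matrix_trace).neg)
  have hcc : ∀ i : ι, Continuous fun t : S => -τ (Matrix.trace (β * (uu i * t.1 + t.1 * uu' i))) := fun i =>
    (hτc.comp (continuous_const.matrix_mul ((continuous_const.matrix_mul continuous_subtype_val).add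
      (continuous_subtype_val.matrix_mul continuous_const))).matrix_trace).neg
  have hprops := fun (i : ι) (z : v.adicCompletion F) (hz : z ∈ primePowBall (v.adicCompletion F) j) => hqL i z hz
  refine setIntegral_shell_eq_zero_of_levi F E c hcδ hδ hd v n hT₀ hJD S hS μ (hf s) (hfU s) (hφm s)
    (χ := fun t : S => ((ψ (-τ (Matrix.trace (β * t.1))) : Circle) : ℂ)) hχcont.measurable (fun t => by rw [Circle.norm_coe])
    μF hψ hdψ j ((hBm (-k)).diff (hBm (-k + 1))) (((measure_mono Set.sdiff_subset).trans_lt (lt_top_iff_ne_top.2 (hBfin (-k)))).ne) hB0 (hBfin 0)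
    (C := C) (fun t ht => hC t ht.1) (Finset.univ : Finset ι) q L (fun i t => -τ (Matrix.trace (β * (uu i * t.1 + t.1 * uu' i))))
    (fun i _ => (hcc i).measurable)
    (fun i _ z hz => (hprops i z hz).1) (fun i _ z hz => (hprops i z hz).2.1) (fun i _ z hz => (hprops i z hz).2.2.1)
    (fun i _ z hz => (hprops i z hz).2.2.2.1) (fun i _ z hz => (hprops i z hz).2.2.2.2.1) (fun i _ z hz => (hprops i z hz).2.2.2.2.2.1)
    (fun i _ z hz => (hprops i z hz).2.2.2.2.2.2.2.2 0) (fun i _ z hz => ?_) (fun i _ z hz t ht => ?_) (fun i _ i' _ z hz t ht => ?_)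
    (fun t ht => ?_)
  · -- the shell is preserved
    rw [Set.preimage_sdiff, (hprops i z hz).2.2.2.2.2.2.2.2 (-k), (hprops i z hz).2.2.2.2.2.2.2.2 (-k + 1)]
  · -- the character factorisation on the shell
    obtain ⟨-, -, -, -, -, hLf, hA, hDinv, -⟩ := hprops i z hz
    show ((ψ (-τ (Matrix.trace (β * (L i z t).1))) : Circle) : ℂ) = _
    rw [hLf t, hA, hDinv, whittakerChar_levi_conj F E v ψ hτadd hτs β (uu i) (uu' i) t.1 z,
      addChar_quadratic_term_eq_one F E c v hπ hdψ hτ hb h2j hβ (hb2 i) (hb2' i) ht.1 hz, mul_one]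
  · -- the boxes are permuted
    obtain ⟨-, -, -, -, -, hLf, hA, hDinv, -⟩ := hprops i' z hz
    have hsub := linear_coeff_sub_mem F E c v hπ hτ hτadd hτs hb hbj h2j (u := uu i) (u' := uu' i) (u₁ := uu i') (u₁' := uu' i') hβ
      (hb2 i) (hb2' i) (hb2 i') (hb2' i') ht.1 hz
    show -τ (Matrix.trace (β * (uu i * (L i' z t).1 + (L i' z t).1 * uu' i))) ∈ primePowBall (v.adicCompletion F) (d - j) ↔ _
    rw [hLf t, hA, hDinv]
    exact neg_mem_primePowBall_iff_of_sub_mem F v hsub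
  · -- the covering: a point of the shell has a coefficient outside `𝔭^{d−j}`
    by_contra hall
    push Not at hall
    have hcoef : ∀ a b₁ : Fin n, ∀ e ∈ ({1, ε} : Set (LocalRing E v)),
        τ (Matrix.trace (β * (Matrix.single a b₁ e * t.1 + t.1 * (T⁻¹ * ((Matrix.single a b₁ e).map (conjLocal E c v))ᵀ * T)))) ∈
          primePowBall (v.adicCompletion F) (d - j) := by
      intro a b₁ e he
      rcases he with rfl | rfl
      · have h' := neg_mem_primePowBall (hall ((a, b₁), false) (Finset.mem_univ _))
        rw [neg_neg] at h'
        exact h'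
      · have h' := neg_mem_primePowBall (hall ((a, b₁), true) (Finset.mem_univ _))
        rw [neg_neg] at h'
        exact h'
    have hball := mball_of_forall_coeff_mem F E c v hπ hcδ hδ hτ hτadd hT hTt hεσ hεint hε h2 hββ hβinv hβskew ((hS t.1).1 t.2) hcoef
    apply ht.2
    intro i j' w
    have h := hball i j' w
    rwa [show d - j - cε - c₂ - b' = -k + 1 by omega] at h

end Summit.HodgeConjecture.HodgeConjecture.Cruxes.HLiu418.K2LiuBadPlaceWhittakerFarShellsRadii

end
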